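import Mathlib
import Summits.Ventures.PercRepro2.PMK5Deg2KernelUB
import Summits.Ventures.PercRepro2.Deg2UBConn
import Summits.Ventures.PercRepro2.Deg2UBKron
import Summits.Ventures.PercRepro2.Deg2UBDigits
import Summits.Ventures.PercRepro2.Deg2UBTables

/-!
# THEOREM 26 — ROW 2′TRI AND (HCOV) ON `K₅ + {a₃u, a₃b}`, THE FIRST NON-LEAF SIX-VERTEX FAMILY, IN THE KERNEL
(blind cell PercRepro2, mine-2 g26; typer-1's `K5TypedK3.lean` on the twelve-edge skeleton; census M2-60,
kit j258912, two own codes)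

By `Deg2UBTables.K3_apply`, on `K₅ + {a₃u, a₃b}` with the marks `(o, a₁, a₂, a₃, b) = (0, 1, 2, 5, 4)` the
kernel `K₃ x y w` is a signed sum of twenty products of tables, so a typed count `typedCount F z τ K₃` is the
signed triple count of the profile `k` of the minor `(F, z, τ)` (`typedCount_K3_eq`: `cntPos k − cntNeg k`).
The kernel certificate `cert` (`PMK5Deg2KernelUB.lean`, one `decide +kernel` over `Fin 12 → Bool`) reads
the counts off the base-`KB` digits of `kPos`, `kNeg` (`kPos_eq`, `kNeg_eq` through `kron_eq_kronSum` and
`kronSum_mul_mul`; `le_of_kron_le'`: the digits of `kNeg` are below `2^23` by the third mask test, the counts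
are below `KB`, so the subtraction borrows nowhere), hence

* **`cntNeg_le_cntPos`**: `∀ k, cntNeg k ≤ cntPos k`;
* **`typedCount_K3_nonneg`**: every weight-free typed count of `K₃` on the twelve-edge graph is `≥ 0` —
  all minors `(F, z)`, all type maps;
* **`typedBases`**: `CovForm.TypedBases ends12 0 1 2 5 4` — row 2′TRI on `K₅ + {a₃u, a₃b}`;
* **`HCov_deg2ub`**: `CovForm.HCov p ends12 0 1 2 5 4` for every probability vector `p : Fin 12 → R` — (HCOV)
  on every instance of the family (the ten base edges and the two `a₃`-edges at any weights, missing edges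
  at weight `0`), unconditionally, by `CovForm.HCov_of_typedBases`.
-/

namespace Summit.Ventures.PercRepro2

open Hub

namespace Deg2UB

/-! ## Typed counts are signed triple counts -/

section Counts

variable {R : Type*} [Field R]

/-- The positive triple counts of `K₃` on `K₅ + {a₃u, a₃b}`. -/
def cntPos (k : Fin 12 → Fin 4) : ℕ :=
  cnt3 tPD tQ t4p k + cnt3 tQ tPDoU t5p k + cnt3 tPD tQ t6m k +
    cnt3 tPD (t7p 4) (t7m 0) k + cnt3 tPD (t7m 4) (t7p 0) k +
    cnt3 tPDoU (t7p 4) (t7m 5) k + cnt3 tPDoU (t7m 4) (t7p 5) k +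
    cnt3 tPD (t7p 4) t10p k + cnt3 tPD (t7m 4) t10m k + cnt3 tQ t12 tPDoU k

/-- The negative triple counts of `K₃` on `K₅ + {a₃u, a₃b}`. -/
def cntNeg (k : Fin 12 → Fin 4) : ℕ :=
  cnt3 tPD tQ t4m k + cnt3 tQ tPDoU t5m k + cnt3 tPD tQ t6p k +
    cnt3 tPD (t7p 4) (t7p 0) k + cnt3 tPD (t7m 4) (t7m 0) k +
    cnt3 tPDoU (t7p 4) (t7p 5) k + cnt3 tPDoU (t7m 4) (t7m 5) k +
    cnt3 tPD (t7p 4) t10m k + cnt3 tPD (t7m 4) t10p k + cnt3 tPD tQ t11 k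

/-- The profile of a minor `(F, z)` with types `τ ≤ 3` on `F`: `τ` on `F`, `3 · z` off `F`. -/
lemma exists_profile (F : Finset (Fin 12)) (z : Config (Fin 12)) (τ : Fin 12 → ℕ)
    (hτ : ∀ e ∈ F, τ e ≤ 3) :
    ∃ k : Fin 12 → Fin 4, ∀ e, (k e : ℕ) = if e ∈ F then τ e else if z e then 3 else 0 := by
  refine ⟨fun e => if he : e ∈ F then ⟨τ e, Nat.lt_succ_of_le (hτ e he)⟩ else if z e then 3 else 0,
    fun e => ?_⟩
  by_cases he : e ∈ F
  · simp [he]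
  · simp only [dif_neg he, if_neg he]
    cases z e <;> rfl

/-- The constraint of a typed count is the profile constraint `prof x y w = k`. -/
lemma typed_constraint_iff (F : Finset (Fin 12)) (z : Config (Fin 12)) (τ : Fin 12 → ℕ)
    (k : Fin 12 → Fin 4) (hk : ∀ e, (k e : ℕ) = if e ∈ F then τ e else if z e then 3 else 0)
    (x y w : Config (Fin 12)) :
    ((∀ e, e ∉ F → x e = z e ∧ y e = z e ∧ w e = z e) ∧ (∀ e ∈ F, openCount x y w e = τ e)) ↔
      prof x y w = k := by
  constructor
  · rintro ⟨h1, h2⟩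
    funext e
    apply Fin.ext
    rw [hk e]
    by_cases he : e ∈ F
    · rw [if_pos he]
      exact h2 e he
    · rw [if_neg he]
      obtain ⟨hx, hy, hw⟩ := h1 e he
      simp only [Hub.prof, hx, hy, hw]
      cases z e <;> rfl
  · intro hprof
    constructor
    · intro e he
      have := congrArg (fun f => (f e : ℕ)) hprof
      simp only [Hub.prof] at this
      rw [hk e, if_neg he] at this
      revert this
      cases z e <;> cases x e <;> cases y e <;> cases w e <;> intro this <;> simp at this ⊢
    · intro e he
      have := congrArg (fun f => (f e : ℕ)) hprof
      simp only [Hub.prof] at this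
      rw [hk e, if_pos he] at this
      exact this

/-- The typed count of a product of three tables is the triple count of the profile. -/
lemma typedCount_tables (F : Finset (Fin 12)) (z : Config (Fin 12)) (τ : Fin 12 → ℕ)
    (k : Fin 12 → Fin 4) (hk : ∀ e, (k e : ℕ) = if e ∈ F then τ e else if z e then 3 else 0)
    (T₁ T₂ T₃ : (Fin 12 → Bool) → Bool) :
    typedCount F z τ (fun x y w => indR (R := R) T₁ x * indR T₂ y * indR T₃ w) =
      ((cnt3 T₁ T₂ T₃ k : ℕ) : R) := by
  rw [← coef3_eq_cnt3]
  unfold typedCount coef3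
  simp only [typed_constraint_iff F z τ k hk, Finset.sum_filter, Fintype.sum_prod_type]

/-- A typed count is linear in the kernel (sums). -/
lemma typedCount_add (F : Finset (Fin 12)) (z : Config (Fin 12)) (τ : Fin 12 → ℕ)
    (K K' : Config (Fin 12) → Config (Fin 12) → Config (Fin 12) → R) :
    typedCount F z τ (fun x y w => K x y w + K' x y w) = typedCount F z τ K + typedCount F z τ K' := by
  unfold typedCount
  simp only [← Finset.sum_add_distrib]
  refine Finset.sum_congr rfl fun x _ => Finset.sum_congr rfl fun y _ =>
    Finset.sum_congr rfl fun w _ => ?_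
  split_ifs <;> simp

/-- A typed count is linear in the kernel (differences). -/
lemma typedCount_sub (F : Finset (Fin 12)) (z : Config (Fin 12)) (τ : Fin 12 → ℕ)
    (K K' : Config (Fin 12) → Config (Fin 12) → Config (Fin 12) → R) :
    typedCount F z τ (fun x y w => K x y w - K' x y w) = typedCount F z τ K - typedCount F z τ K' := by
  unfold typedCount
  simp only [← Finset.sum_sub_distrib]
  refine Finset.sum_congr rfl fun x _ => Finset.sum_congr rfl fun y _ =>
    Finset.sum_congr rfl fun w _ => ?_
  split_ifs <;> simp

/-- **A typed count of `K₃` on `K₅ + {a₃u, a₃b}` is the signed triple count of its profile.** -/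
lemma typedCount_K3_eq (F : Finset (Fin 12)) (z : Config (Fin 12)) (τ : Fin 12 → ℕ)
    (k : Fin 12 → Fin 4) (hk : ∀ e, (k e : ℕ) = if e ∈ F then τ e else if z e then 3 else 0) :
    typedCount F z τ (CovForm.K3 (R := R) ends12 0 1 2 5 4) =
      ((cntPos k : ℕ) : R) - ((cntNeg k : ℕ) : R) := by
  have hK : CovForm.K3 (R := R) ends12 0 1 2 5 4 = fun x y w =>
      (indR tPD x * indR tQ y * indR t4p w + indR tQ x * indR tPDoU y * indR t5p w +
        indR tPD x * indR tQ y * indR t6m w +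
        indR tPD x * indR (t7p 4) y * indR (t7m 0) w + indR tPD x * indR (t7m 4) y * indR (t7p 0) w +
        indR tPDoU x * indR (t7p 4) y * indR (t7m 5) w + indR tPDoU x * indR (t7m 4) y * indR (t7p 5) w +
        indR tPD x * indR (t7p 4) y * indR t10p w + indR tPD x * indR (t7m 4) y * indR t10m w +
        indR tQ x * indR t12 y * indR tPDoU w) -
      (indR tPD x * indR tQ y * indR t4m w + indR tQ x * indR tPDoU y * indR t5m w +
        indR tPD x * indR tQ y * indR t6p w +
        indR tPD x * indR (t7p 4) y * indR (t7p 0) w + indR tPD x * indR (t7m 4) y * indR (t7m 0) w +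
        indR tPDoU x * indR (t7p 4) y * indR (t7p 5) w + indR tPDoU x * indR (t7m 4) y * indR (t7m 5) w +
        indR tPD x * indR (t7p 4) y * indR t10m w + indR tPD x * indR (t7m 4) y * indR t10p w +
        indR tPD x * indR tQ y * indR t11 w) := by
    funext x y w
    exact K3_apply x y w
  rw [hK, typedCount_sub]
  simp only [typedCount_add, typedCount_tables F z τ k hk]
  unfold cntPos cntNeg
  push_cast
  ring

end Counts

/-! ## The digit bridge -/

section Digits

/-- Ten Kronecker sums combine. -/
lemma sum_add_mul10 (f₁ f₂ f₃ f₄ f₅ f₆ f₇ f₈ f₉ f₁₀ : (Fin 12 → Fin 4) → ℕ) :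
    ∑ k, f₁ k * KB ^ idx4 k + ∑ k, f₂ k * KB ^ idx4 k + ∑ k, f₃ k * KB ^ idx4 k +
      ∑ k, f₄ k * KB ^ idx4 k + ∑ k, f₅ k * KB ^ idx4 k + ∑ k, f₆ k * KB ^ idx4 k +
      ∑ k, f₇ k * KB ^ idx4 k + ∑ k, f₈ k * KB ^ idx4 k + ∑ k, f₉ k * KB ^ idx4 k +
      ∑ k, f₁₀ k * KB ^ idx4 k =
      ∑ k, (f₁ k + f₂ k + f₃ k + f₄ k + f₅ k + f₆ k + f₇ k + f₈ k + f₉ k + f₁₀ k) * KB ^ idx4 k := by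
  simp only [← Finset.sum_add_distrib]
  exact Finset.sum_congr rfl fun k _ => by ring

/-- `kPos` carries the positive counts. -/
lemma kPos_eq : kPos = ∑ k, cntPos k * KB ^ idx4 k := by
  unfold kPos
  simp only [kron_eq_kronSum, kronSum_mul_mul]
  rw [sum_add_mul10]
  rfl

/-- `kNeg` carries the negative counts. -/
lemma kNeg_eq : kNeg = ∑ k, cntNeg k * KB ^ idx4 k := by
  unfold kNeg
  simp only [kron_eq_kronSum, kronSum_mul_mul]
  rw [sum_add_mul10]
  rfl

/-- `KB = 16777216`. -/
lemma KB_val : KB = 16777216 := by rw [KB_eq]; norm_num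

/-- The positive counts are below `KB` (ten counts `≤ 3^12`). -/
lemma cntPos_lt (k : Fin 12 → Fin 4) : cntPos k < KB := by
  unfold cntPos
  rw [KB_val]
  have := cnt3_le tPD tQ t4p k
  have := cnt3_le tQ tPDoU t5p k
  have := cnt3_le tPD tQ t6m k
  have := cnt3_le tPD (t7p 4) (t7m 0) k
  have := cnt3_le tPD (t7m 4) (t7p 0) k
  have := cnt3_le tPDoU (t7p 4) (t7m 5) k
  have := cnt3_le tPDoU (t7m 4) (t7p 5) k
  have := cnt3_le tPD (t7p 4) t10p k
  have := cnt3_le tPD (t7m 4) t10m k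
  have := cnt3_le tQ t12 tPDoU k
  omega

/-- The negative counts are below `KB`. -/
lemma cntNeg_lt (k : Fin 12 → Fin 4) : cntNeg k < KB := by
  unfold cntNeg
  rw [KB_val]
  have := cnt3_le tPD tQ t4m k
  have := cnt3_le tQ tPDoU t5m k
  have := cnt3_le tPD tQ t6p k
  have := cnt3_le tPD (t7p 4) (t7p 0) k
  have := cnt3_le tPD (t7m 4) (t7m 0) k
  have := cnt3_le tPDoU (t7p 4) (t7p 5) k
  have := cnt3_le tPDoU (t7m 4) (t7m 5) k
  have := cnt3_le tPD (t7p 4) t10m k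
  have := cnt3_le tPD (t7m 4) t10p k
  have := cnt3_le tPD tQ t11 k
  omega

/-- **Every typed coefficient of `K₃` on `K₅ + {a₃u, a₃b}` is `≥ 0`**: `cntNeg k ≤ cntPos k`, from the
kernel certificate `cert`. -/
theorem cntNeg_le_cntPos (k : Fin 12 → Fin 4) : cntNeg k ≤ cntPos k :=
  le_of_kron_le' cntPos cntNeg cntPos_lt cntNeg_lt kPos_eq kNeg_eq cert.1 cert.2.1 cert.2.2 k

end Digits

/-! ## The typed base and (HCOV) on the family -/

section Base

variable {R : Type*} [Field R] [LinearOrder R] [IsStrictOrderedRing R]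

/-- **Every weight-free typed count of `K₃` on `K₅ + {a₃u, a₃b}` is nonnegative** — all minors `(F, z)`,
all type maps. -/
theorem typedCount_K3_nonneg (F : Finset (Fin 12)) (z : Config (Fin 12)) (τ : Fin 12 → ℕ) :
    0 ≤ typedCount F z τ (CovForm.K3 (R := R) ends12 0 1 2 5 4) := by
  by_cases hτ : ∀ e ∈ F, τ e ≤ 3
  · obtain ⟨k, hk⟩ := exists_profile F z τ hτ
    rw [typedCount_K3_eq F z τ k hk, sub_nonneg]
    exact_mod_cast cntNeg_le_cntPos k
  · have : typedCount F z τ (CovForm.K3 (R := R) ends12 0 1 2 5 4) = 0 := by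
      unfold typedCount
      refine Finset.sum_eq_zero fun x _ => Finset.sum_eq_zero fun y _ =>
        Finset.sum_eq_zero fun w _ => ?_
      rw [if_neg]
      rintro ⟨-, h2⟩
      apply hτ
      intro e he
      rw [← h2 e he]
      unfold openCount
      have := Bool.toNat_le (x e)
      have := Bool.toNat_le (y e)
      have := Bool.toNat_le (w e)
      omega
    rw [this]

/-- **THEOREM 26 (typed form): row 2′TRI on `K₅ + {a₃u, a₃b}`** — `CovForm.TypedBases ends12 0 1 2 5 4`,
unconditionally. -/
theorem typedBases : CovForm.TypedBases (R := R) ends12 0 1 2 5 4 :=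
  fun F z τ _ => typedCount_K3_nonneg F z τ

/-- **THEOREM 26: (HCOV) on every `K₅ + {a₃u, a₃b}` instance** — `CovForm.HCov p ends12 0 1 2 5 4` for
every probability vector `p : Fin 12 → R` (the first non-leaf six-vertex family, every weight vector,
missing edges at weight `0`). -/
theorem HCov_deg2ub (p : Fin 12 → R) (hp : IsProbVec p) : CovForm.HCov p ends12 0 1 2 5 4 :=
  CovForm.HCov_of_typedBases ends12 0 1 2 5 4 typedBases p hp

end Base

end Deg2UB

end Summit.Ventures.PercRepro2
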